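import Literature.MathematicalPhysics.QuantumLattice.DWaveSourceFreeGainBound
import Literature.MathematicalPhysics.QuantumLattice.TorusCooperSum

/-!
# Crux `TwSourcedCondensation` (item `stmt-HubbardSuperconductivity-1697`): the torus Cooper logarithm with
its constant made explicit in the distance `d₀` to the band edge

`--supports` file of the standing disprover (generation 3); no definition introduced. The tree's
`Literature…TorusFermiWeightSum.exists_sum_fermiWeight_le` hides its constant behind `∃ C(d₀)`; the band-edge
obstruction (`BandEdge.lean`) needs the dependence on `d₀`, so the SAME proof is replayed with the constant
exposed:

* `sum_fermiWeight_le_explicit` — `Σ_k β/(2 + β|ε_L(k) - μ|) ≤ (4/d₀ + (2/log 2 + 2)·4/(π√(d₀/8)))(1 + log β)L²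
  + 8βL` for `d₀ ≤ μ + 4`, `d₀ ≤ -μ`, `β ≥ 1`, all `L`;
* `fermiWeightConst_le` — that constant is `≤ 4(1 + 2/log 2 + 2)/d₀` for `d₀ ≤ 1`.
Tree: `fermiWeight_le_dyadic`, `card_torusShell_le`, `exists_nat_pow_near` (verbatim replay of
`exists_sum_fermiWeight_le`, Salmhofer 1999 §4.5.4 for the physics).
-/

noncomputable section

namespace Summit.HubbardSuperconductivity.HubbardSuperconductivity.Theorems.TwSourcedCondensation.Negative

open Matrix Finset Literature.MathematicalPhysics.QuantumLattice Literature.Probability.LatticeModels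

/-! ### The torus Cooper logarithm with its constant made explicit in `d₀` -/

section FermiWeight

open Real

variable {L : ℕ} [NeZero L]

/-- **The Fermi-surface weight sum with explicit constant** (the tree's `exists_sum_fermiWeight_le`,
constant exposed): for `d₀ ≤ μ + 4`, `d₀ ≤ -μ`, `β ≥ 1`, all `L ≥ 1`,
`Σ_k β/(2 + β|ε_L(k) - μ|) ≤ (4/d₀ + (2/log 2 + 2)·4/(π√(d₀/8)))·(1 + log β) L² + 8βL`. [folklore] -/
theorem sum_fermiWeight_le_explicit {d₀ : ℝ} (hd₀ : 0 < d₀) (μ : ℝ) (hμ4 : d₀ ≤ μ + 4) (hμ0 : d₀ ≤ -μ)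
    {β : ℝ} (hβ : 1 ≤ β) (L : ℕ) [NeZero L] :
    ∑ k : TorusSite 2 L, β / (2 + β * |torusBand L k - μ|) ≤
      (4 / d₀ + (2 / Real.log 2 + 2) * (4 / (π * Real.sqrt (d₀ / 8)))) * (1 + Real.log β) * (L : ℝ) ^ 2 +
        8 * β * L := by
  set s₀ := Real.sqrt (d₀ / 8) with hs₀def
  have hs₀ : 0 < s₀ := Real.sqrt_pos.2 (by positivity)
  set κ : ℝ := 2 / Real.log 2 + 2 with hκ
  have hlog2 : 0 < Real.log 2 := Real.log_pos one_lt_two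
  have hκpos : 0 < κ := by positivity
  have hL : (0 : ℝ) < L := by exact_mod_cast Nat.pos_of_ne_zero (NeZero.ne L)
  have hlogβ : 0 ≤ Real.log β := Real.log_nonneg hβ
  set B := β / 2 with hBdef
  have hB : 0 < B := by positivity
  set η₀ := d₀ / 4 with hη₀def
  have hη₀ : 0 < η₀ := by positivity
  have hd₀2 : d₀ ≤ 2 := by linarith
  have hw : ∀ k : TorusSite 2 L, β / (2 + β * |torusBand L k - μ|) = B / (1 + B * |torusBand L k - μ|) := by
    intro k
    rw [hBdef]
    have : 0 < 2 + β * |torusBand L k - μ| := by positivity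
    field_simp
  simp only [hw]
  have hcardL : (Finset.univ : Finset (TorusSite 2 L)).card = L ^ 2 := by
    rw [Finset.card_univ, Fintype.card_pi, Fin.prod_univ_two, ZMod.card, sq]
  by_cases hsmall : B * η₀ ≤ 1
  · have hbound : ∀ k : TorusSite 2 L, B / (1 + B * |torusBand L k - μ|) ≤ 4 / d₀ := fun k => by
      refine (div_le_self hB.le (by nlinarith [abs_nonneg (torusBand L k - μ)])).trans ?_
      rw [le_div_iff₀ hd₀]
      rw [hη₀def] at hsmall
      linarith
    calc ∑ k : TorusSite 2 L, B / (1 + B * |torusBand L k - μ|) ≤ ∑ _k : TorusSite 2 L, 4 / d₀ :=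
          Finset.sum_le_sum fun k _ => hbound k
      _ = 4 / d₀ * (L : ℝ) ^ 2 := by rw [Finset.sum_const, hcardL, nsmul_eq_mul]; push_cast; ring
      _ ≤ (4 / d₀ + κ * (4 / (π * s₀))) * (1 + Real.log β) * (L : ℝ) ^ 2 + 8 * β * L := by
          have h1 : (0 : ℝ) ≤ κ * (4 / (π * s₀)) := by positivity
          have h2 : (0 : ℝ) ≤ (L : ℝ) ^ 2 := by positivity
          nlinarith [mul_nonneg h1 h2, mul_nonneg (mul_nonneg (show (0:ℝ) ≤ 4 / d₀ + κ * (4 / (π * s₀)) by positivity) hlogβ) h2]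
  · rw [not_le] at hsmall
    obtain ⟨n, hn1, hn2⟩ := exists_nat_pow_near hsmall.le one_lt_two
    set J := n + 1 with hJdef
    have hJ1 : η₀ ≤ 2 ^ J / B := by
      rw [le_div_iff₀ hB, hJdef]; linarith
    have hJ2 : (2 : ℝ) ^ J / B ≤ d₀ / 2 := by
      rw [div_le_iff₀ hB, hJdef, pow_succ]; nlinarith
    have hJ3 : ((J : ℕ) : ℝ) + 1 ≤ κ * (1 + Real.log β) := by
      have hBη : B * η₀ ≤ β := by rw [hBdef, hη₀def]; nlinarith
      have hn : (n : ℝ) * Real.log 2 ≤ Real.log β := by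
        rw [← Real.log_pow]
        exact Real.log_le_log (by positivity) (hn1.trans hBη)
      have hc : 0 < (Real.log 2)⁻¹ := inv_pos.2 hlog2
      have hn' : (n : ℝ) ≤ Real.log β * (Real.log 2)⁻¹ := by
        rw [← div_eq_mul_inv, le_div_iff₀ hlog2]; exact hn
      rw [hJdef, hκ, div_eq_mul_inv]
      push_cast
      nlinarith [mul_nonneg hc.le hlogβ]
    have hpt : ∀ k : TorusSite 2 L, B / (1 + B * |torusBand L k - μ|) ≤
        1 / η₀ + ∑ j ∈ Finset.range (J + 1), (if |torusBand L k - μ| < 2 ^ j / B then 2 * B / 2 ^ j else 0) :=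
      fun k => fermiWeight_le_dyadic hB (abs_nonneg _) hη₀ hJ1
    have hcount : ∀ j ∈ Finset.range (J + 1),
        ∑ k : TorusSite 2 L, (if |torusBand L k - μ| < 2 ^ j / B then 2 * B / 2 ^ j else (0 : ℝ)) ≤
          4 * (L : ℝ) ^ 2 / (π * s₀) + 8 * B * L / 2 ^ j := by
      intro j hj
      have hjJ : j ≤ J := Nat.lt_succ_iff.1 (Finset.mem_range.1 hj)
      have hηj : 0 < (2 : ℝ) ^ j / B := by positivity
      have hηj' : (2 : ℝ) ^ j / B ≤ d₀ / 2 :=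
        le_trans (div_le_div_of_nonneg_right (pow_le_pow_right₀ one_le_two hjJ) hB.le) hJ2
      have hN := card_torusShell_le (L := L) hμ4 hμ0 hηj hηj'
      rw [← hs₀def] at hN
      rw [← Finset.sum_filter, Finset.sum_const, nsmul_eq_mul]
      calc (((Finset.univ.filter fun k : TorusSite 2 L => |torusBand L k - μ| < 2 ^ j / B).card : ℕ) : ℝ) * (2 * B / 2 ^ j)
          ≤ 4 * (L * (2 ^ j / B * L / (2 * π * s₀) + 1)) * (2 * B / 2 ^ j) :=
            mul_le_mul_of_nonneg_right hN (by positivity)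
        _ = 4 * (L : ℝ) ^ 2 / (π * s₀) + 8 * B * L / 2 ^ j := by
            field_simp
            ring
    have hgeom : ∑ j ∈ Finset.range (J + 1), (8 * B * (L : ℝ) / 2 ^ j) ≤ 16 * B * L := by
      have hg := geom_sum_Ico_le_of_lt_one (show (0 : ℝ) ≤ 1 / 2 by norm_num) (show (1 : ℝ) / 2 < 1 by norm_num)
        (m := 0) (n := J + 1)
      simp only [pow_zero, Finset.range_eq_Ico] at hg ⊢
      calc ∑ j ∈ Finset.Ico 0 (J + 1), 8 * B * (L : ℝ) / 2 ^ j
          = 8 * B * L * ∑ j ∈ Finset.Ico 0 (J + 1), ((1 : ℝ) / 2) ^ j := by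
            rw [Finset.mul_sum]
            refine Finset.sum_congr rfl fun j _ => ?_
            rw [one_div, inv_pow]; ring
        _ ≤ 8 * B * L * (1 / (1 - 1 / 2)) := by gcongr
        _ = 16 * B * L := by norm_num; ring
    calc ∑ k : TorusSite 2 L, B / (1 + B * |torusBand L k - μ|)
        ≤ ∑ k : TorusSite 2 L, (1 / η₀ + ∑ j ∈ Finset.range (J + 1),
            (if |torusBand L k - μ| < 2 ^ j / B then 2 * B / 2 ^ j else 0)) := Finset.sum_le_sum fun k _ => hpt k
      _ = (L : ℝ) ^ 2 / η₀ + ∑ j ∈ Finset.range (J + 1), ∑ k : TorusSite 2 L,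
            (if |torusBand L k - μ| < 2 ^ j / B then 2 * B / 2 ^ j else (0 : ℝ)) := by
          rw [Finset.sum_add_distrib, Finset.sum_const, hcardL, nsmul_eq_mul, Finset.sum_comm]
          push_cast; ring
      _ ≤ (L : ℝ) ^ 2 / η₀ + ∑ j ∈ Finset.range (J + 1), (4 * (L : ℝ) ^ 2 / (π * s₀) + 8 * B * L / 2 ^ j) := by
          gcongr with j hj
          exact hcount j hj
      _ = (L : ℝ) ^ 2 / η₀ + ((J : ℕ) + 1 : ℝ) * (4 * (L : ℝ) ^ 2 / (π * s₀)) +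
            ∑ j ∈ Finset.range (J + 1), (8 * B * (L : ℝ) / 2 ^ j) := by
          rw [Finset.sum_add_distrib, Finset.sum_const, Finset.card_range, nsmul_eq_mul]
          push_cast; ring
      _ ≤ (L : ℝ) ^ 2 / η₀ + κ * (1 + Real.log β) * (4 * (L : ℝ) ^ 2 / (π * s₀)) + 16 * B * L := by
          gcongr
      _ ≤ (4 / d₀ + κ * (4 / (π * s₀))) * (1 + Real.log β) * (L : ℝ) ^ 2 + 8 * β * L := by
          rw [hη₀def, hBdef]
          have h2 : (0 : ℝ) ≤ (L : ℝ) ^ 2 := by positivity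
          have h3 : (L : ℝ) ^ 2 / (d₀ / 4) = 4 / d₀ * (L : ℝ) ^ 2 := by field_simp
          have h4 : κ * (1 + Real.log β) * (4 * (L : ℝ) ^ 2 / (π * s₀)) =
              κ * (4 / (π * s₀)) * (1 + Real.log β) * (L : ℝ) ^ 2 := by ring
          have h5 : (0 : ℝ) ≤ 4 / d₀ * Real.log β * (L : ℝ) ^ 2 :=
            mul_nonneg (mul_nonneg (by positivity) hlogβ) h2
          rw [h3, h4]
          nlinarith [h5]

/-- The explicit Fermi-weight constant is `≤ 4(1 + κ₀)/d₀` for `d₀ ≤ 1` (`√(d₀/8) ≥ d₀/3`, `π > 3`),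
`κ₀ = 2/log 2 + 2`. [folklore] -/
theorem fermiWeightConst_le {d₀ : ℝ} (hd₀ : 0 < d₀) (hd₀1 : d₀ ≤ 1) :
    4 / d₀ + (2 / Real.log 2 + 2) * (4 / (π * Real.sqrt (d₀ / 8))) ≤ (4 + 4 * (2 / Real.log 2 + 2)) / d₀ := by
  have hlog2 : 0 < Real.log 2 := Real.log_pos one_lt_two
  set κ₀ : ℝ := 2 / Real.log 2 + 2 with hκ₀
  have hκ₀pos : 0 < κ₀ := by positivity
  have hs : d₀ / 3 ≤ Real.sqrt (d₀ / 8) := by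
    rw [show d₀ / 3 = Real.sqrt ((d₀ / 3) ^ 2) by rw [Real.sqrt_sq (by positivity)]]
    exact Real.sqrt_le_sqrt (by nlinarith)
  have hspos : 0 < Real.sqrt (d₀ / 8) := Real.sqrt_pos.2 (by positivity)
  have hπ := Real.pi_gt_three
  -- `4/(π s) ≤ 4/(3 · d₀/3) = 4/d₀`
  have h1 : 4 / (π * Real.sqrt (d₀ / 8)) ≤ 4 / d₀ := by
    apply div_le_div_of_nonneg_left (by norm_num) hd₀
    nlinarith [mul_le_mul hπ.le hs (by positivity) (by positivity)]
  have h2 : κ₀ * (4 / (π * Real.sqrt (d₀ / 8))) ≤ κ₀ * (4 / d₀) := mul_le_mul_of_nonneg_left h1 hκ₀pos.le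
  have e : (4 + 4 * κ₀) / d₀ = 4 / d₀ + κ₀ * (4 / d₀) := by field_simp
  rw [e]
  linarith

end FermiWeight

end Summit.HubbardSuperconductivity.HubbardSuperconductivity.Theorems.TwSourcedCondensation.Negative
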